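import Summits.QuantumFields.BalabanUV.T4Continuum.Spine.NE1p.DressedRoot

/-!
# T⁴ programme, spine estimate NE1′ (node O3b/H2) — leaf S3 `uniformConstants_cell`: THE ARITHMETIC OF THE WALL, DECIDED ONCE
# (leaves L-F (w7), L-S (w6), F-7 (w4) of the owner skeleton `t4/skeletons/NE1p-t4-ne1p-p1.md` §2 ∕ §6 seat S3)

Cell `pub-balaban`, sub-cell `t4`, BINDER-OWNERS row NE1′, formalisation crew `b2b-balaban-t4-ne1p-formalise-*`, seat
`…-leaf-09` (claim table `t4/formal/NE1p/LEAVES.md` row S3; trigger `t4/T4-NE1p-TRIGGER.json` c1, caveats k1 ∕ k2).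
ADDITIVE — imports `Spine/NE1p/DressedRoot` ONLY, modifies nothing.

WHAT THIS FILE DOES.  END-B `DressedRoot.dressedStability_of_bookingLeaves` wants ONE `U : UniformConstants` — K- and μ-FREE
numbers `(C, A₀, ρ₁, τ, Λ, N₀, ρ′, s̄⁰, m)` with (w7) `Λ·ρ₁·τ ≤ ρ′ < 1` and (w6) `m·N₀A₀(1−ρ′)⁻¹ ≤ 1 − s̄⁰` — and, per cutoff,
`BookingLeaves U …` whose arithmetic fields are (w7) `hrate : ρ k + C·c k ≤ ρ₁` for the per-step transport rates `ρ k = ψ·α k`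
of END-F (`transportLeaf_of_centredExponent`, whose own arithmetic binder is (w4) `hdom : e³·(1 + 4θ∕ϱ) ≤ α k`).  This leaf
builds that `U` ONCE from the cell's displayed numbers and discharges every arithmetic binder from DISPLAYED, K-∕μ-free
hypotheses — nothing of Bałaban's densities is asserted, no numeric `L` is taken from print (caveat k2: Bałaban's `L` is «a
fixed large integer»; the located largeness enters as an EXPLICIT binder):

* §1 (w4)∕F-7: `alphaCell κ = e³·(1 + 4κ)` — the uniform step factor for a K-free bound `θ ≤ κ·ϱ` of the fluctuation diameter
  by the chart radius at every met step (owner's `OWNER-ANSWERS-g23.md` §G «Q-scale ∕ r_k — PARTIAL»: the ratio `θ∕ϱ` is the located quantity); `hdom_of_ratio` = END-F's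
  binder `hdom` VERBATIM with `α := fun _ => alphaCell κ`.
* §2 (w7)∕L-F: `rhoOne ψ C c̄ κ = ψ·alphaCell κ + C·c̄` — the uniform family factor for a transverse rate `ψ` (F-6's READING
  `ψ = L⁻²`, load-bearing, caveat k3 — a displayed parameter here), a K-free regeneration bound `c k ≤ c̄` ((w5), displayed) and
  the transport constant `C = 4c_δ∕r`; `hrate_of_bounds` = the field `BookingLeaves.hrate` VERBATIM with `ρ := fun i => ψ·α i`.
* §3 (w7): the strict product in the cell's numbers `(Λ, ψ, τ) = (L⁴, L⁻², L⁻³)`: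
  `L⁴·rhoOne L⁻² C c̄ κ·L⁻³ = e³(1+4κ)∕L + L·C·c̄ =: locCell L C c̄ κ` (`prod_cell`; `T4TrajectoryDensityFreshStep.dressedProduct_cell`
  is the `c̄ = 0`, `κ = 0` case) — so (w7) IS the located inequality `locCell L C c̄ κ ≤ ρ′ < 1` (record `t4/T4-EST-NE1p-P1.md`
  §5 (29): «e³∕L + L·C·c < 1, a largeness condition on L»), carried as a BINDER; §6 gives its EXPLICIT-`L₀` form
  `alphaCell κ ∕ η ≤ L ∧ L·C·c̄ ≤ η′ ⟹ locCell ≤ η + η′` (largeness of `L` AND smallness of the regeneration constant against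
  `L·C` — both displayed, neither printed).
* §4 (w6)∕L-S: the source window — with `A₀ = a₁·μ₀` (amplitude per unit source strength × window radius) the smallness
  `m·N₀A₀(1−ρ′)⁻¹ ≤ 1 − s̄⁰` holds for every `μ₀ ≤ muWindow s̄⁰ ρ′ m N₀ a₁ := (1−s̄⁰)(1−ρ′)∕(m·N₀·a₁)` (`hsmall_of_le_muWindow`).
* §5 THE CONSTRUCTOR `uniformConstantsCell` : `UniformConstants` with `(C, A₀, ρ₁, τ, Λ, N₀, ρ′, s̄⁰, m) =
  (C, A₀, rhoOne L⁻² C c̄ κ, L⁻³, L⁴, N₀, ρ′, s̄⁰, m)` from the binders `1 ≤ L`, signs, `locCell ≤ ρ′ < 1`, (w6); field `simp` lemmas.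
* §6 explicit largeness (`locCell_le_of_largeL`, `uniformConstantsOfLargeL`); §7 `bookingLeavesCell` — the per-cutoff bundle
  `BookingLeaves (uniformConstantsCell …) Bk T` with its three arithmetic fields `hρ`∕`hc`∕`hrate` DISCHARGED, the wall binders
  (w3-book) `hS`∕`hcount`, (w2-act) `hs₀`, (w1)+(w5b) `hbirth`, T `htr`, (w5) `hreg` displayed UNCHANGED; §8 a DECIDED numeral
  instance (`L = 41`, `κ = c̄ = 0`, …) inhabiting the constructor's binder family — non-vacuity of the arithmetic, not a claim
  about Bałaban's `L`.

HONEST FRAMING.  Kernel arithmetic over displayed binders ([folklore] real-number bookkeeping; 0 sorry; 0 citations used as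
facts).  Every result reads «(w7)∕(w6)∕(w4) ⇐ the located largeness + the regeneration smallness + the window», NEVER «NE1′
proved»; the wall of record (w1), (w2-act) THE NUMBER, (w3)⁺, (w5), F-6's rate stands; 0 leaves instantiated on Bałaban's
densities; spine PROVED 0∕9.  Rung (B)+1 on ONE finite four-torus — NOT infinite volume, NOT a mass gap, NOT OS on ℝ⁴, NOT
Clay.  HONEST DEPENDENCY: continuum YM on T⁴ ⇐ BetaPertH ∧ nine spine estimates (0/9 proved); BetaPertH ⇐ (D1) ∧ (D4) ∧
CAP+tail; G-an2-4 gates asym, D1 and NE2/3/4.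
-/

noncomputable section

namespace Summit.QuantumFields.BalabanUV.T4Continuum.NE1p.DressedUniformConstants

open Finset
open scoped BigOperators
open Literature.MathematicalPhysics.QuantumFieldTheory.Balaban1983to89
open Literature.MathematicalPhysics.QuantumFieldTheory.Balaban1983to89.T4TermFormat
open Literature.MathematicalPhysics.QuantumFieldTheory.Balaban1983to89.T4TrajectoryComparison
open Summit.QuantumFields.BalabanUV.T4Continuum.T4TrajectoryDensityDressed
open Summit.QuantumFields.BalabanUV.T4Continuum.NE1p.DressedRoot

/-! ## §1 (w4) ∕ F-7: the uniform step factor -/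

/-- **THE UNIFORM STEP FACTOR** [shape]: `alphaCell κ = e³·(1 + 4κ)` — the dressed per-step cost `e³` (the per-step budget
`s⁰ + s₁ ≤ 1` absorbed, `T4TrajectoryDensityFreshStep.stepCost_le`) times the chart-motion factor `1 + 4θ∕ϱ` at a K-free ratio
bound `θ ≤ κ·ϱ`.  A number; nothing asserted. [folklore] -/
def alphaCell (κ : ℝ) : ℝ := Real.exp 3 * (1 + 4 * κ)

/-- `alphaCell κ > 0` for `κ ≥ 0`. [folklore] -/
theorem alphaCell_pos {κ : ℝ} (hκ : 0 ≤ κ) : 0 < alphaCell κ := by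
  unfold alphaCell; positivity

/-- `alphaCell κ ≥ 0` for `κ ≥ 0`. [folklore] -/
theorem alphaCell_nonneg {κ : ℝ} (hκ : 0 ≤ κ) : 0 ≤ alphaCell κ := (alphaCell_pos hκ).le

/-- The bare step cost is below the uniform factor: `e³ ≤ alphaCell κ`. [folklore] -/
theorem exp_three_le_alphaCell {κ : ℝ} (hκ : 0 ≤ κ) : Real.exp 3 ≤ alphaCell κ := by
  unfold alphaCell
  have h := Real.exp_pos 3
  nlinarith

/-- `alphaCell` is monotone in the ratio bound. [folklore] -/
theorem alphaCell_mono {κ κ' : ℝ} (h : κ ≤ κ') : alphaCell κ ≤ alphaCell κ' := by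
  unfold alphaCell
  exact mul_le_mul_of_nonneg_left (by linarith) (Real.exp_pos 3).le

/-- **(w4) AT ONE MET STEP** [arith]: a fluctuation diameter `θ ≤ κ·ϱ` on a chart of radius `ϱ > 0` costs at most the uniform
factor, `e³·(1 + 4θ∕ϱ) ≤ alphaCell κ`. [folklore] -/
theorem hdom_cell {θ ϱ κ : ℝ} (hϱ : 0 < ϱ) (h : θ ≤ κ * ϱ) : Real.exp 3 * (1 + 4 * θ / ϱ) ≤ alphaCell κ := by
  unfold alphaCell
  have hq : 4 * θ / ϱ ≤ 4 * κ := by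
    rw [div_le_iff₀ hϱ]
    nlinarith
  exact mul_le_mul_of_nonneg_left (by linarith) (Real.exp_pos 3).le

/-- **(w4) ∕ F-7 IN END-F's BINDER SHAPE** [arith]: the binder `hdom` of `DressedRoot.transportLeaf_of_centredExponent` VERBATIM with
the constant step-factor profile `α := fun _ => alphaCell κ`, from positive chart radii and the K-free ratio bound `θ b k ≤ κ·ϱ b k′ k`
at every met step of every generation ((w3)⁺'s window schedule supplies `θ`, `ϱ`; the RATIO bound is the located quantity of the
owner's `OWNER-ANSWERS-g23.md` §G — displayed, not asserted). [folklore] -/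
theorem hdom_of_ratio {B : T4TermFormat.Booking} {θ : B.Birth → ℕ → ℝ} {ϱ : B.Birth → ℕ → ℕ → ℝ} {κ : ℝ}
    (hϱ : ∀ b k' k, 0 < ϱ b k' k)
    (hratio : ∀ (b : B.Birth) (k' k : ℕ), B.birthScale b ≤ k' → k' ≤ k → k + 1 ≤ B.K → θ b k ≤ κ * ϱ b k' k) :
    ∀ (b : B.Birth) (k' k : ℕ), B.birthScale b ≤ k' → k' ≤ k → k + 1 ≤ B.K →
      Real.exp 3 * (1 + 4 * θ b k / ϱ b k' k) ≤ (fun _ : ℕ => alphaCell κ) k :=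
  fun b k' k hb hk' hk => hdom_cell (hϱ b k' k) (hratio b k' k hb hk' hk)

/-! ## §2 (w7) ∕ L-F: the uniform family factor -/

/-- **THE UNIFORM FAMILY FACTOR** [shape]: `rhoOne ψ C c̄ κ = ψ·alphaCell κ + C·c̄` — transport rate `ψ·α` plus the regeneration
cost `C·c̄` inside the rate (record §5 (29), the STEPWISE format).  `ψ` = the transverse rate (F-6's reading `L⁻²`), `C = 4c_δ∕r`,
`c̄` a K-free bound of the regeneration constants ((w5)).  A number; nothing asserted. [folklore] -/
def rhoOne (ψ C cbar κ : ℝ) : ℝ := ψ * alphaCell κ + C * cbar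

/-- Sign of the family factor. [folklore] -/
theorem rhoOne_nonneg {ψ C cbar κ : ℝ} (hψ : 0 ≤ ψ) (hC : 0 ≤ C) (hcbar : 0 ≤ cbar) (hκ : 0 ≤ κ) :
    0 ≤ rhoOne ψ C cbar κ := by
  unfold rhoOne
  have := alphaCell_nonneg hκ
  positivity

/-- **(w7) AT ONE STEP** [arith]: `ψ·alphaCell κ + C·c ≤ rhoOne ψ C c̄ κ` whenever `c ≤ c̄` and `C ≥ 0`. [folklore] -/
theorem hrate_cell {ψ C cbar κ c : ℝ} (hC : 0 ≤ C) (hc : c ≤ cbar) :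
    ψ * alphaCell κ + C * c ≤ rhoOne ψ C cbar κ := by
  unfold rhoOne
  have := mul_le_mul_of_nonneg_left hc hC
  linarith

/-- **(w7) ∕ L-F IN THE FIELD SHAPE OF `BookingLeaves.hrate`** [arith]: with the per-step rates `ρ := fun i => ψ·α i` of END-F's
conclusion at the constant profile `α := fun _ => alphaCell κ` and regeneration constants `c k ≤ c̄`:
`∀ k < K, ρ k + C·c k ≤ rhoOne ψ C c̄ κ`. [folklore] -/
theorem hrate_of_bounds {ψ C cbar κ : ℝ} {c : ℕ → ℝ} {K : ℕ} (hC : 0 ≤ C) (hc : ∀ k, k < K → c k ≤ cbar) :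
    ∀ k, k < K → (fun i : ℕ => ψ * (fun _ : ℕ => alphaCell κ) i) k + C * c k ≤ rhoOne ψ C cbar κ :=
  fun k hk => hrate_cell hC (hc k hk)

/-! ## §3 (w7): the strict product in the cell's numbers -/

/-- **THE LOCATED QUANTITY** [shape]: `locCell L C c̄ κ = e³(1+4κ)∕L + L·C·c̄` — the strict product `Λ·ρ₁·τ` evaluated at the
cell's numbers `(Λ, ψ, τ) = (L⁴, L⁻², L⁻³)` (`prod_cell`).  (w7) is `locCell ≤ ρ′ < 1`: largeness of `L` against `e³(1+4κ)` AND
smallness of the regeneration constant against `L·C` (record §5 (29); b02's (R-cost)).  NOT printed; a binder. [folklore] -/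
def locCell (L C cbar κ : ℝ) : ℝ := alphaCell κ / L + L * C * cbar

/-- Sign of the located quantity. [folklore] -/
theorem locCell_nonneg {L C cbar κ : ℝ} (hL : 0 ≤ L) (hC : 0 ≤ C) (hcbar : 0 ≤ cbar) (hκ : 0 ≤ κ) :
    0 ≤ locCell L C cbar κ := by
  unfold locCell
  have := alphaCell_nonneg hκ
  positivity

/-- **THE STRICT PRODUCT IN THE CELL'S NUMBERS** [arith]: `L⁴ · rhoOne L⁻² C c̄ κ · (L⁻¹)³ = locCell L C c̄ κ` for `L > 0`
(generalises `T4TrajectoryDensityFreshStep.dressedProduct_cell`, the `κ = c̄ = 0` case `L⁴·(e³L⁻²)·L⁻³ = e³∕L`). [folklore] -/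
theorem prod_cell {L C cbar κ : ℝ} (hL : 0 < L) :
    L ^ 4 * rhoOne (L ^ 2)⁻¹ C cbar κ * L⁻¹ ^ 3 = locCell L C cbar κ := by
  unfold rhoOne locCell
  field_simp

/-- The source decay `τ = L⁻³ ≤ 1` for `L ≥ 1`. [folklore] -/
theorem tau_cell_le_one {L : ℝ} (hL : 1 ≤ L) : L⁻¹ ^ 3 ≤ (1 : ℝ) :=
  pow_le_one₀ (inv_nonneg.mpr (by linarith)) (inv_le_one_of_one_le₀ hL)

/-- The source decay is nonnegative for `L ≥ 1`. [folklore] -/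
theorem tau_cell_nonneg {L : ℝ} (hL : 1 ≤ L) : (0 : ℝ) ≤ L⁻¹ ^ 3 :=
  pow_nonneg (inv_nonneg.mpr (by linarith)) 3

/-! ## §4 (w6) ∕ L-S: the source window -/

/-- **THE SOURCE WINDOW** [shape]: `muWindow s̄⁰ ρ′ m N₀ a₁ = (1 − s̄⁰)(1 − ρ′)∕(m·N₀·a₁)` — the largest window radius `μ₀` for which
the class amplitude `A₀ = a₁·μ₀` (amplitude `a₁` per unit source strength) satisfies the K-free smallness (w6).  A number. [folklore] -/
def muWindow (sbar ρ' m N₀ a₁ : ℝ) : ℝ := (1 - sbar) * (1 - ρ') / (m * N₀ * a₁)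

/-- **(w6) FROM THE WINDOW** [arith]: for `m·N₀·a₁ > 0`, `ρ′ < 1` and `0 ≤ μ₀ ≤ muWindow s̄⁰ ρ′ m N₀ a₁`, the smallness
`m·(N₀·(a₁μ₀)·(1−ρ′)⁻¹) ≤ 1 − s̄⁰` — the field `UniformConstants.hsmall` with `A₀ := a₁·μ₀`. [folklore] -/
theorem hsmall_of_le_muWindow {sbar ρ' m N₀ a₁ μ₀ : ℝ} (hpos : 0 < m * N₀ * a₁) (hρ' : ρ' < 1)
    (hμ₀ : μ₀ ≤ muWindow sbar ρ' m N₀ a₁) :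
    m * (N₀ * (a₁ * μ₀) * (1 - ρ')⁻¹) ≤ 1 - sbar := by
  have h1 : 0 < 1 - ρ' := by linarith
  have hprod : m * N₀ * a₁ * μ₀ ≤ (1 - sbar) * (1 - ρ') := by
    have := mul_le_mul_of_nonneg_left hμ₀ hpos.le
    rwa [muWindow, mul_div_cancel₀ _ hpos.ne'] at this
  calc m * (N₀ * (a₁ * μ₀) * (1 - ρ')⁻¹) = m * N₀ * a₁ * μ₀ / (1 - ρ') := by
        rw [div_eq_mul_inv]; ring
    _ ≤ (1 - sbar) * (1 - ρ') / (1 - ρ') := div_le_div_of_nonneg_right hprod h1.le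
    _ = 1 - sbar := mul_div_cancel_right₀ _ h1.ne'

/-- **(w6), DEGENERATE CASE** [arith]: with no source (`m·N₀·A₀ = 0`) the smallness is the bare action margin `s̄⁰ ≤ 1`. [folklore] -/
theorem hsmall_of_zero {sbar ρ' m N₀ A₀ : ℝ} (h0 : m * N₀ * A₀ = 0) (hsbar : sbar ≤ 1) :
    m * (N₀ * A₀ * (1 - ρ')⁻¹) ≤ 1 - sbar := by
  have : m * (N₀ * A₀ * (1 - ρ')⁻¹) = m * N₀ * A₀ * (1 - ρ')⁻¹ := by ring
  rw [this, h0, zero_mul]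
  linarith

/-! ## §5 The constructor -/

/-- **`uniformConstants_cell` — THE K- AND μ-FREE CONSTANTS OF THE DRESSED FORMAT, BUILT ONCE** [bookkeeping]: from the block size
`L ≥ 1`, the transport constant `C ≥ 0`, the regeneration bound `c̄ ≥ 0`, the diameter∕radius ratio bound `κ ≥ 0`, the positional
multiplicity `N₀ ≥ 0`, the class amplitude `A₀ ≥ 0`, the source factor `m ≥ 0`, the action margin `s̄⁰`, and a `ρ′` with the
LOCATED LARGENESS `locCell L C c̄ κ ≤ ρ′ < 1` ((w7); explicit-`L₀` form in §6) and the window smallness (w6) — the term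
`U : UniformConstants` with `(Λ, ρ₁, τ) = (L⁴, rhoOne L⁻² C c̄ κ, L⁻³)`.  Every input is a displayed real number; `U` precedes
`∀ p` and `∀ K` by construction (RULING R-t4r2-Q2, caveat k1).  Nothing asserted for Bałaban's scheme. [folklore] -/
def uniformConstantsCell (L C cbar κ N₀ A₀ m sbar ρ' : ℝ) (hL : 1 ≤ L) (hC : 0 ≤ C) (hcbar : 0 ≤ cbar) (hκ : 0 ≤ κ)
    (hN₀ : 0 ≤ N₀) (hA₀ : 0 ≤ A₀) (hm : 0 ≤ m) (hloc : locCell L C cbar κ ≤ ρ') (hρ'1 : ρ' < 1)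
    (hsmall : m * (N₀ * A₀ * (1 - ρ')⁻¹) ≤ 1 - sbar) : UniformConstants where
  C := C
  A₀ := A₀
  ρ₁ := rhoOne (L ^ 2)⁻¹ C cbar κ
  τ := L⁻¹ ^ 3
  Λ := L ^ 4
  N₀ := N₀
  ρ' := ρ'
  sbar := sbar
  m := m
  hC := hC
  hA₀ := hA₀
  hρ₁ := rhoOne_nonneg (inv_nonneg.mpr (sq_nonneg L)) hC hcbar hκ
  hτ0 := tau_cell_nonneg hL
  hτ1 := tau_cell_le_one hL
  hΛ := pow_nonneg (by linarith) 4
  hN₀ := hN₀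
  hm := hm
  hρ'1 := hρ'1
  hprod := by rw [prod_cell (by linarith)]; exact hloc
  hsmall := hsmall

section Fields

variable {L C cbar κ N₀ A₀ m sbar ρ' : ℝ} {hL : 1 ≤ L} {hC : 0 ≤ C} {hcbar : 0 ≤ cbar} {hκ : 0 ≤ κ}
  {hN₀ : 0 ≤ N₀} {hA₀ : 0 ≤ A₀} {hm : 0 ≤ m} {hloc : locCell L C cbar κ ≤ ρ'} {hρ'1 : ρ' < 1}
  {hsmall : m * (N₀ * A₀ * (1 - ρ')⁻¹) ≤ 1 - sbar}

/-- Field read-out: transport constant. [folklore] -/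
@[simp] theorem uniformConstantsCell_C :
    (uniformConstantsCell L C cbar κ N₀ A₀ m sbar ρ' hL hC hcbar hκ hN₀ hA₀ hm hloc hρ'1 hsmall).C = C := rfl

/-- Field read-out: class amplitude. [folklore] -/
@[simp] theorem uniformConstantsCell_A₀ :
    (uniformConstantsCell L C cbar κ N₀ A₀ m sbar ρ' hL hC hcbar hκ hN₀ hA₀ hm hloc hρ'1 hsmall).A₀ = A₀ := rfl

/-- Field read-out: family factor `ρ₁ = L⁻²·e³(1+4κ) + C·c̄`. [folklore] -/
@[simp] theorem uniformConstantsCell_ρ₁ :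
    (uniformConstantsCell L C cbar κ N₀ A₀ m sbar ρ' hL hC hcbar hκ hN₀ hA₀ hm hloc hρ'1 hsmall).ρ₁ =
      rhoOne (L ^ 2)⁻¹ C cbar κ := rfl

/-- Field read-out: source decay `τ = L⁻³`. [folklore] -/
@[simp] theorem uniformConstantsCell_τ :
    (uniformConstantsCell L C cbar κ N₀ A₀ m sbar ρ' hL hC hcbar hκ hN₀ hA₀ hm hloc hρ'1 hsmall).τ = L⁻¹ ^ 3 := rfl

/-- Field read-out: positional count rate `Λ = L⁴`. [folklore] -/
@[simp] theorem uniformConstantsCell_Λ :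
    (uniformConstantsCell L C cbar κ N₀ A₀ m sbar ρ' hL hC hcbar hκ hN₀ hA₀ hm hloc hρ'1 hsmall).Λ = L ^ 4 := rfl

/-- Field read-out: positional multiplicity. [folklore] -/
@[simp] theorem uniformConstantsCell_N₀ :
    (uniformConstantsCell L C cbar κ N₀ A₀ m sbar ρ' hL hC hcbar hκ hN₀ hA₀ hm hloc hρ'1 hsmall).N₀ = N₀ := rfl

/-- Field read-out: strict-product bound. [folklore] -/
@[simp] theorem uniformConstantsCell_ρ' :
    (uniformConstantsCell L C cbar κ N₀ A₀ m sbar ρ' hL hC hcbar hκ hN₀ hA₀ hm hloc hρ'1 hsmall).ρ' = ρ' := rfl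

/-- Field read-out: action margin. [folklore] -/
@[simp] theorem uniformConstantsCell_sbar :
    (uniformConstantsCell L C cbar κ N₀ A₀ m sbar ρ' hL hC hcbar hκ hN₀ hA₀ hm hloc hρ'1 hsmall).sbar = sbar := rfl

/-- Field read-out: source factor. [folklore] -/
@[simp] theorem uniformConstantsCell_m :
    (uniformConstantsCell L C cbar κ N₀ A₀ m sbar ρ' hL hC hcbar hκ hN₀ hA₀ hm hloc hρ'1 hsmall).m = m := rfl

end Fields

/-! ## §6 (w7) with an EXPLICIT largeness binder `L₀ ≤ L` (caveat k2) -/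

/-- **THE EXPLICIT LARGENESS THRESHOLD** [shape]: `LzeroCell κ η = e³(1+4κ)∕η` — `L ≥ LzeroCell κ η` iff the transport part of the
located quantity is `≤ η`.  For `κ = 0`, `η → 1⁻` this is the record's «L > e³ ≈ 20.1»; NO numeral is taken from print. [folklore] -/
def LzeroCell (κ η : ℝ) : ℝ := alphaCell κ / η

/-- **(w7) FROM `L₀ ≤ L` AND THE REGENERATION SMALLNESS** [arith]: for a split `η > 0`, `LzeroCell κ η ≤ L` and `L·C·c̄ ≤ η′`
give `locCell L C c̄ κ ≤ η + η′`; with `η + η′ < 1` this is (w7) with `ρ′ := η + η′`. [folklore] -/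
theorem locCell_le_of_largeL {L C cbar κ η η' : ℝ} (hκ : 0 ≤ κ) (hη : 0 < η) (hL : LzeroCell κ η ≤ L)
    (hreg : L * C * cbar ≤ η') : locCell L C cbar κ ≤ η + η' := by
  have hα := alphaCell_pos hκ
  have hL0 : 0 < L := lt_of_lt_of_le (by unfold LzeroCell; positivity) hL
  have h1 : alphaCell κ / L ≤ η := by
    rw [div_le_iff₀ hL0]
    have := (div_le_iff₀ hη).mp hL
    linarith
  unfold locCell
  linarith

/-- `LzeroCell κ η ≥ e³ > 1` for `0 < η ≤ 1`, so `L ≥ L₀` forces `L ≥ 1`. [folklore] -/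
theorem one_le_of_LzeroCell_le {L κ η : ℝ} (hκ : 0 ≤ κ) (hη : 0 < η) (hη1 : η ≤ 1) (hL : LzeroCell κ η ≤ L) : 1 ≤ L := by
  have h3 : (1 : ℝ) ≤ Real.exp 3 := Real.one_le_exp (by norm_num)
  have hα : Real.exp 3 ≤ alphaCell κ := exp_three_le_alphaCell hκ
  have hdiv : alphaCell κ ≤ alphaCell κ / η := le_div_self (alphaCell_nonneg hκ) hη hη1
  unfold LzeroCell at hL
  linarith

/-- **THE CONSTRUCTOR WITH THE EXPLICIT `L₀`** [bookkeeping]: `LzeroCell κ η ≤ L`, `L·C·c̄ ≤ η′`, `η + η′ < 1`, signs and the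
window (w6) at `ρ′ := η + η′` give the uniform constants. [folklore] -/
def uniformConstantsOfLargeL (L C cbar κ N₀ A₀ m sbar η η' : ℝ) (hκ : 0 ≤ κ) (hη : 0 < η) (hη1 : η ≤ 1)
    (hL : LzeroCell κ η ≤ L) (hC : 0 ≤ C) (hcbar : 0 ≤ cbar) (hreg : L * C * cbar ≤ η') (hsplit : η + η' < 1)
    (hN₀ : 0 ≤ N₀) (hA₀ : 0 ≤ A₀) (hm : 0 ≤ m) (hsmall : m * (N₀ * A₀ * (1 - (η + η'))⁻¹) ≤ 1 - sbar) :
    UniformConstants :=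
  uniformConstantsCell L C cbar κ N₀ A₀ m sbar (η + η') (one_le_of_LzeroCell_le hκ hη hη1 hL) hC hcbar hκ hN₀ hA₀ hm
    (locCell_le_of_largeL hκ hη hL hreg) hsplit hsmall

/-! ## §7 The per-cutoff leaf bundle with its arithmetic discharged -/

/-- **`BookingLeaves` OVER THE CELL'S CONSTANTS WITH THE ARITHMETIC FIELDS DISCHARGED** [bookkeeping]: at one cutoff, given the
per-step regeneration constants `0 ≤ c k ≤ c̄`, action margins `s⁰ ≤ s̄⁰`, live-family finsets with their positional count at rate
`L⁴` ((w3-book), seat S4's supplier), and the three gated leaves (w1)+(w5b) `hbirth`, T `htr` (END-F at `C`, `ρ i = L⁻²·alphaCell κ`),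
(w5) `hreg` — all displayed UNCHANGED — the bundle `BookingLeaves (uniformConstantsCell …) Bk T`; its fields `hρ`, `hc`, `hrate`
((w7)) are theorems of §2.  Feed `∀ p K` of these to END-B `dressedStability_of_bookingLeaves`. [folklore] -/
def bookingLeavesCell {L C cbar κ N₀ A₀ m sbar ρ' : ℝ} (hL : 1 ≤ L) (hC : 0 ≤ C) (hcbar : 0 ≤ cbar) (hκ : 0 ≤ κ)
    (hN₀ : 0 ≤ N₀) (hA₀ : 0 ≤ A₀) (hm : 0 ≤ m) (hloc : locCell L C cbar κ ≤ ρ') (hρ'1 : ρ' < 1)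
    (hsmall : m * (N₀ * A₀ * (1 - ρ')⁻¹) ≤ 1 - sbar)
    {Bk : T4TermFormat.Booking} {T : Trajectory Bk} (c : ℕ → ℝ) (s₀ : Bk.Birth → ℕ → ℝ)
    (S : ℕ → Bk.Birth → Finset Bk.Birth)
    (hc0 : ∀ k, 0 ≤ c k) (hcb : ∀ k, k < Bk.K → c k ≤ cbar)
    (hS : ∀ k b, ∀ f ∈ S k b, Bk.birthScale f ≤ k)
    (hcount : ∀ k b, ∀ j ≤ k, (((S k b).filter fun f => Bk.birthScale f = j).card : ℝ) ≤ N₀ * (L ^ 4) ^ (k - j))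
    (hs₀ : ∀ b k, s₀ b k ≤ sbar)
    (hbirth : T.BirthsFromOld C (fun _ : ℕ => (L ^ 2)⁻¹ * alphaCell κ)
      (twoRate A₀ (rhoOne (L ^ 2)⁻¹ C cbar κ) (L⁻¹ ^ 3) Bk.K)
      (budgetGate T s₀ m S C (fun _ : ℕ => (L ^ 2)⁻¹ * alphaCell κ)))
    (htr : T.TransportsFromVar C (fun _ : ℕ => (L ^ 2)⁻¹ * alphaCell κ)
      (budgetGate T s₀ m S C (fun _ : ℕ => (L ^ 2)⁻¹ * alphaCell κ)))
    (hreg : T.RegeneratesFromVar c (budgetGate T s₀ m S C (fun _ : ℕ => (L ^ 2)⁻¹ * alphaCell κ))) :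
    BookingLeaves (uniformConstantsCell L C cbar κ N₀ A₀ m sbar ρ' hL hC hcbar hκ hN₀ hA₀ hm hloc hρ'1 hsmall) Bk T where
  ρ := fun _ => (L ^ 2)⁻¹ * alphaCell κ
  c := c
  s₀ := s₀
  S := S
  hρ := fun _ => mul_nonneg (inv_nonneg.mpr (sq_nonneg L)) (alphaCell_nonneg hκ)
  hc := hc0
  hrate := fun k hk => hrate_cell hC (hcb k hk)
  hS := hS
  hcount := hcount
  hs₀ := hs₀
  hbirth := hbirth
  htr := htr
  hreg := hreg

/-- **END-B OVER THE CELL'S CONSTANTS** [bookkeeping]: one set of displayed numbers with (w7)'s located largeness and (w6)'s window,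
and at EVERY run parameter and cutoff the per-cutoff leaves of `bookingLeavesCell`'s input list ⟹ `DressedStability 𝒯` — by
`dressedStability_of_bookingLeaves` BY NAME.  «NE1′ ⇐ the named binders»; nothing instantiated on Bałaban's densities. [folklore] -/
theorem dressedStability_of_cell {P : Type*} (𝒯 : DressedTower P) {L C cbar κ N₀ A₀ m sbar ρ' : ℝ} (hL : 1 ≤ L)
    (hC : 0 ≤ C) (hcbar : 0 ≤ cbar) (hκ : 0 ≤ κ) (hN₀ : 0 ≤ N₀) (hA₀ : 0 ≤ A₀) (hm : 0 ≤ m)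
    (hloc : locCell L C cbar κ ≤ ρ') (hρ'1 : ρ' < 1) (hsmall : m * (N₀ * A₀ * (1 - ρ')⁻¹) ≤ 1 - sbar)
    (leaves : ∀ p K, BookingLeaves
      (uniformConstantsCell L C cbar κ N₀ A₀ m sbar ρ' hL hC hcbar hκ hN₀ hA₀ hm hloc hρ'1 hsmall) (𝒯.B p K) (𝒯.T p K)) :
    DressedStability 𝒯 :=
  dressedStability_of_bookingLeaves _ 𝒯 leaves

/-! ## §8 A decided numeral instance (non-vacuity of the binder family; NOT Bałaban's `L`) -/

/-- `e³ < 20.5` (from `e < 2.7182818286`). [folklore] -/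
theorem exp_three_lt : Real.exp 3 < 20.5 := by
  have h3 : Real.exp 3 = Real.exp 1 ^ 3 := by rw [← Real.exp_nat_mul]; norm_num
  have hup : Real.exp 1 ^ 3 < (2.7182818286 : ℝ) ^ 3 :=
    pow_lt_pow_left₀ Real.exp_one_lt_d9 (Real.exp_pos 1).le three_ne_zero
  rw [h3]
  nlinarith [hup]

/-- DECIDED: at `L = 41`, `κ = 0`, `c̄ = 0` the located quantity is `e³∕41 ≤ 1∕2`. [folklore] -/
theorem locCell_fortyOne : locCell 41 1 0 0 ≤ 1 / 2 := by
  unfold locCell alphaCell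
  have h := exp_three_lt
  norm_num
  rw [div_le_iff₀ (by norm_num : (0:ℝ) < 41)]
  linarith

/-- **A DECIDED INSTANCE OF THE CONSTRUCTOR** [decided toy]: the numerals `L = 41`, `C = 1`, `c̄ = 0`, `κ = 0`, `N₀ = A₀ = 1`,
`m = 1∕8`, `s̄⁰ = 1∕2`, `ρ′ = 1∕2` inhabit every binder of `uniformConstantsCell` (`(1∕8)·(1·1·2) = 1∕4 ≤ 1∕2`) — the binder
family is jointly satisfiable with K-∕μ-free numerals.  NOT a statement about Bałaban's `L` (caveat k2). [folklore] -/
def cellNumeralWitness : UniformConstants :=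
  uniformConstantsCell 41 1 0 0 1 1 (1 / 8) (1 / 2) (1 / 2) (by norm_num) zero_le_one le_rfl le_rfl zero_le_one
    zero_le_one (by norm_num) locCell_fortyOne (by norm_num) (by norm_num)

/-- The witness's family factor is the bare dressed transport rate `e³∕41²`. [folklore] -/
theorem cellNumeralWitness_ρ₁ : cellNumeralWitness.ρ₁ = (41 ^ 2 : ℝ)⁻¹ * Real.exp 3 := by
  simp [cellNumeralWitness, rhoOne, alphaCell]

end Summit.QuantumFields.BalabanUV.T4Continuum.NE1p.DressedUniformConstants

end
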